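import Summits.CriticalPhenomena.PercolationContinuityZ3.Theorems.PercNearOneGluingNoHeavyLowerTailSahiLatinMoves

/-!
# `NoHeavyLowerTail` (crux stmt-CriticalPhenomena-4575), Sahi programme (prim-master-conj gen 42): COEFFICIENTWISE HARRIS in every
# dimension (T1) — the Latin kernel with a full slot, `κ(Ω,b,c) = Σ_u (N_{b∩c}(u) − Λ_{bc}(u)) ≥ 0`

Support file (`--supports stmt-CriticalPhenomena-4575`; companion of `…SahiLatinKernel/Moves`).  Memo
`run/shared/lean/prim/prim-l12/FROM-prim-master-conj-g41-DESCENT.md` §5 (T1).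

Double counting through the Latin-sum identity `SahiLatin.sum_lperm_eq_sum_link`:
* `sum_N : Σ_u N_s(u) = 2^d |s|`, `sum_ind_mul_N : Σ_u [u∈c] N_b(u) = L(c,b)`, `sum_Lam : Σ_u Λ_{bc}(u) = L(b,c)`, `latinPairs_comm : L(b,c) = L(c,b)`,
  where `latinPairs b c = #{Latin ordered pairs (x,y) : x ∈ b, y ∈ c}` (`= Σ_ρ [ρ·0 ∈ b][ρ·1 ∈ c]`);
* `kappa_univ : κ(Ω,b,c) = Σ_u (N_{b∩c}(u) − Λ_{bc}(u))` and **`kappa_univ_nonneg`** (T1): for up-sets `b, c`, `κ(Ω,b,c) ≥ 0` —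
  termwise antipodal Harris on the links (`SahiLatin.Lam_le_N`).  Since Sahi's `E₃(1,g,h) = E₂(g,h)`, this is the polarised
  (coefficientwise) Harris inequality on products of chains; it is the order-2 input of the order-4 ladder (memo §10, Lemma A₄).
Everything here is proved; axioms standard.
-/

namespace Summit.CriticalPhenomena.PercolationContinuityZ3.Theorems.SahiLatin

open Finset

variable {ι : Type*} [Fintype ι] [DecidableEq ι]

/-- The number of Latin ordered pairs `(x, y)` (`y ∈ link x`) with `x ∈ b`, `y ∈ c`, as a Latin sum. [this work] -/
def latinPairs (b c : Finset (Pt ι)) : ℤ := ∑ ρ : LPerm ι, ind b (lpt ρ 0) * ind c (lpt ρ 1)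

/-- `L(b,c) = L(c,b)`. [this work] -/
theorem latinPairs_comm (b c : Finset (Pt ι)) : latinPairs b c = latinPairs c b := by
  unfold latinPairs
  rw [← sum_lpt_swap01 (fun x y _ => ind c x * ind b y)]
  exact sum_congr rfl fun ρ _ => by ring

/-- `Σ_u [u ∈ c] N_b(u) = L(c,b)`. [this work] -/
theorem sum_ind_mul_N (b c : Finset (Pt ι)) : ∑ u : Pt ι, ind c u * (N b u : ℤ) = latinPairs c b := by
  unfold latinPairs
  rw [sum_lperm_eq_sum_link (fun x y _ => ind c x * ind b y)]
  refine sum_congr rfl fun u _ => ?_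
  rw [N, natCast_card_filter, mul_sum]
  refine sum_congr rfl fun y _ => ?_
  rw [ind_apply b y]

/-- `Σ_u Λ_{bc}(u) = L(b,c)`. [this work] -/
theorem sum_Lam (b c : Finset (Pt ι)) : ∑ u : Pt ι, (Lam b c u : ℤ) = latinPairs b c := by
  unfold latinPairs
  set τ : Equiv.Perm (Fin 3) := Equiv.swap 0 2 * Equiv.swap 0 1 with hτ
  have h0 : τ 0 = 1 := by rw [hτ]; decide
  have h1 : τ 1 = 2 := by rw [hτ]; decide
  rw [← sum_lpt_perm (fun x y _ => ind b x * ind c y) τ, h0, h1, sum_lperm_eq_sum_link (fun _ y z => ind b y * ind c z)]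
  refine sum_congr rfl fun u _ => ?_
  rw [Lam, natCast_card_filter]
  refine sum_congr rfl fun y _ => ?_
  by_cases hb : y ∈ b <;> by_cases hc : anti u y ∈ c <;> simp [ind, hb, hc]

/-- `Σ_u N_s(u) = 2^d |s|`. [this work] -/
theorem sum_N (s : Finset (Pt ι)) : ∑ u : Pt ι, (N s u : ℤ) = 2 ^ Fintype.card ι * s.card := by
  have h1 : ∑ u : Pt ι, (N s u : ℤ) = ∑ ρ : LPerm ι, ind s (lpt ρ 1) := by
    rw [sum_lperm_eq_sum_link (fun _ y _ => ind s y)]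
    refine sum_congr rfl fun u _ => ?_
    rw [N, natCast_card_filter]
    exact sum_congr rfl fun y _ => by rw [ind_apply]
  have h2 : ∑ ρ : LPerm ι, ind s (lpt ρ 1) = ∑ ρ : LPerm ι, ind s (lpt ρ 0) := by
    rw [← sum_lpt_swap01 (fun _ y _ => ind s y)]
  rw [h1, h2, sum_lperm_eq_sum_link (fun x _ _ => ind s x)]
  simp only [sum_const, card_link, nsmul_eq_mul]
  rw [← sum_filter_add_sum_filter_not univ (fun u => u ∈ s)]
  have hin : ∑ u ∈ univ.filter (fun u => u ∈ s), ((2 ^ Fintype.card ι : ℕ) : ℤ) * ind s u = 2 ^ Fintype.card ι * s.card := by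
    rw [filter_univ_mem, sum_congr rfl fun u (hu : u ∈ s) => by rw [ind_of_mem hu, mul_one], sum_const, nsmul_eq_mul]
    push_cast; ring
  have hout : ∑ u ∈ univ.filter (fun u => ¬ u ∈ s), ((2 ^ Fintype.card ι : ℕ) : ℤ) * ind s u = 0 :=
    sum_eq_zero fun u hu => by rw [mem_filter] at hu; rw [ind_of_not_mem hu.2, mul_zero]
  rw [hin, hout, add_zero]

/-- **The full-slot kernel**: `κ(Ω,b,c) = Σ_u (N_{b∩c}(u) − Λ_{bc}(u))`. [this work] -/
theorem kappa_univ (b c : Finset (Pt ι)) : kappa univ b c = ∑ u : Pt ι, ((N (b ∩ c) u : ℤ) - Lam b c u) := by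
  rw [kappa_eq_sum_Phi]
  have hΦ : ∀ u : Pt ι, Phi b c u = 2 * (2 ^ Fintype.card ι * (ind b u * ind c u)) - (N (b ∩ c) u : ℤ) - ind c u * (N b u : ℤ)
      - ind b u * (N c u : ℤ) + (Lam b c u : ℤ) := fun u => by rw [Phi_eq, pow_succ]; ring
  simp only [hΦ, sum_add_distrib, sum_sub_distrib, ← mul_sum]
  have hbc : ∑ u : Pt ι, ind b u * ind c u = ((b ∩ c).card : ℤ) := by
    have : ∀ u : Pt ι, ind b u * ind c u = if u ∈ b ∩ c then 1 else 0 := fun u => by rw [← ind_inter]; rfl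
    simp only [this, sum_boole, filter_univ_mem]
  rw [hbc, sum_ind_mul_N b c, sum_ind_mul_N c b, sum_Lam, latinPairs_comm c b]
  have hN := sum_N (ι := ι) (b ∩ c)
  linarith

/-- **T1 — coefficientwise Harris in every dimension**: for up-sets `b, c` of `[3]^ι`, `κ(Ω,b,c) ≥ 0`. [this work] -/
theorem kappa_univ_nonneg {b c : Finset (Pt ι)} (hb : IsUpperSet (b : Set (Pt ι))) (hc : IsUpperSet (c : Set (Pt ι))) :
    0 ≤ kappa univ b c := by
  rw [kappa_univ]
  exact sum_nonneg fun u _ => by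
    have := Lam_le_N hb hc u
    have : (Lam b c u : ℤ) ≤ N (b ∩ c) u := by exact_mod_cast this
    linarith

end Summit.CriticalPhenomena.PercolationContinuityZ3.Theorems.SahiLatin
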